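import Summits.BirchSwinnertonDyer.BirchSwinnertonDyer.Theses.DefiniteGrossPeriodAtTwo
import Literature.NumberTheory.EllipticCurves.ComplexMultiplicationHasCMIffProofs
import Literature.NumberTheory.QuadraticFields.ClassNumberOneLandauProofs
import Literature.NumberTheory.EllipticCurves.TwoAdicImageQuadraticTwistProofs
import Literature.NumberTheory.EllipticCurves.ExceptionalPrimesDensityModels

/-!
# Route `DefiniteGrossPeriodAtTwo`: glue of the gen-2 split of crux X_Kato `KatoBoundAtTwo` into big-image cells (LINE 12′)

Item stmt-BirchSwinnertonDyer-22974 (`KatoBoundAtTwoOfBigImageCells`, glue of the gen-2 split of crux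
stmt-BirchSwinnertonDyer-23666 `KatoBoundAtTwo` into the four reduction-type CELLS under the twist-invariant big-image
clauses «ρ̄_{E,2} surjective ∧ −Δ non-square», each stated in the parent's own currency
`Finite Ш[2^∞] ∧ ord₂ #Ш[2^∞] ≤ ord₂ Ш_an` — stmt-22966 `MultKatoBoundAtTwoBigImage`, stmt-22971 `OrdKatoBoundAtTwoBigImage`,
stmt-22972 `SupersingularKatoBoundAtTwoBigImage`, stmt-22973 `AdditiveKatoBoundAtTwoBigImage`; idea-crit-5 V100 price 1,
director-bsd (217)(g), pen bsd-idea-1 g8). THEOREM-ONLY file (no definition, no named fact, no `sorry`).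

The glue is bookkeeping: for each member `X ∈ {E, E^(d)}` of the crux (the curve on the habitat and its prime-to-`2N`
quadratic twists, `(d, 2N) = 1`) split on the reduction type of `X` at `2` (good supersingular / good ordinary /
multiplicative / additive) and take the matching cell; the twists inherit ¬CM (`j` is invariant under quadratic twist and
variable change, `hasCM_iff_j_mem_of_heegnerStarkPrime` with the landed Heegner–Stark fact), surjectivity of `ρ̄₂`
(`hasSurjectiveModNGaloisRep_two_quadraticTwist_iff` + `hasSurjectiveModNGaloisRep_smul`) and «`−Δ` non-square»
(`Δ(C • W^(d)) = u⁻¹²·d⁶·Δ(W)` differs from `Δ(W)` by a non-zero square). BSD is not proved by any of this; the parent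
crux is not proved by this file either (it closes the GLUE item only: children ⟹ parent).
-/

set_option autoImplicit false
set_option linter.dupNamespace false

namespace Summit.BirchSwinnertonDyer.BirchSwinnertonDyer.Theorems.DefiniteGrossGlue

open Summit.BirchSwinnertonDyer.BirchSwinnertonDyer.Theses.DefiniteGrossPeriodAtTwo

/-- «`-Δ` is not a square» is invariant under quadratic twist by `d ≠ 0` followed by any change of model:
`Δ(C • W^(d)) = u⁻¹² · d⁶ · Δ(W)`. [folklore] -/
theorem not_isSquare_neg_delta_smul_quadraticTwist (W : WeierstrassCurve ℚ) (C : WeierstrassCurve.VariableChange ℚ)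
    {d : ℚ} (hd : d ≠ 0) (h : ¬ IsSquare (-(W.Δ))) : ¬ IsSquare (-((C • W.quadraticTwist d).Δ)) := by
  rintro ⟨r, hr⟩
  apply h
  rw [WeierstrassCurve.variableChange_Δ, WeierstrassCurve.quadraticTwist_Δ] at hr
  set c : ℚ := ((C.u⁻¹ : ℚˣ) : ℚ) ^ 6 * d ^ 3 with hc
  have hc0 : c ≠ 0 := by
    rw [hc]; exact mul_ne_zero (pow_ne_zero _ (Units.ne_zero _)) (pow_ne_zero _ hd)
  have hrr : r * r = c ^ 2 * (-(W.Δ)) := by rw [← hr, hc]; ring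
  refine ⟨r / c, ?_⟩
  have h1 : (r / c) * (r / c) = (r * r) / c ^ 2 := by ring
  rw [h1, hrr]
  field_simp

/-- **Glue of the LINE-12′ split of `KatoBoundAtTwo` into its four big-image reduction-type cells** (item
stmt-BirchSwinnertonDyer-22974, by name): `MultKatoBoundAtTwoBigImage → OrdKatoBoundAtTwoBigImage →
SupersingularKatoBoundAtTwoBigImage → AdditiveKatoBoundAtTwoBigImage → KatoBoundAtTwo`. Proof: tetrachotomy of the
reduction type at `2` of each member `X ∈ {E, E^(d)}`; transport to the twist of ¬CM (`j`-invariance), of surjective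
`ρ̄₂` (`hasSurjectiveModNGaloisRep_two_quadraticTwist_iff`, `hasSurjectiveModNGaloisRep_smul`) and of «`−Δ` non-square»
(`Δ(C • W^(d)) = u⁻¹² d⁶ Δ(W)`). No GZK: the cells speak the parent's 2-primary currency. [folklore]
[cite: Miller2011LMS, Def. 1.1 (arXiv:1010.2431 p. 3)] -/
theorem katoBoundAtTwoOfBigImageCells_proof : KatoBoundAtTwoOfBigImageCells := by
  intro hM hO hS hA
  have key : ∀ (X : WeierstrassCurve ℚ) [X.IsElliptic] [X.IsGloballyMinimal], ¬ X.HasCM →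
      X.HasSurjectiveModNGaloisRep (2 : ℤ) → ¬ IsSquare (-(X.Δ)) →
      X.analyticRank = 0 → (Finite (AddCommGroup.primaryComponent X.sha 2) ∧ ∃ q : ℚ, Literature.NumberTheory.EllipticCurves.shaAn X = (q : ℂ) ∧ ((padicValNat 2 (Nat.card (AddCommGroup.primaryComponent X.sha 2)) : ℤ) ≤ padicValRat 2 q)) := by
    intro X _ _ hcm hs hnsq hr
    by_cases hg : X.HasGoodReductionAtPrime 2
    · by_cases ha : (2 : ℤ) ∣ X.frobeniusTrace 2
      · exact hS X hcm hs hnsq hr ⟨hg, by exact_mod_cast ha⟩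
      · exact hO X hcm hs hnsq hr ⟨hg, by exact_mod_cast ha⟩
    · by_cases hm : X.HasMultiplicativeReductionAtPrime 2
      · exact hM X hcm hs hnsq hr hm
      · exact hA X hcm hs hnsq hr ⟨hg, hm⟩
  intro W _ _ hcm hH hr
  obtain ⟨hs, hnsq, -⟩ := hH
  refine ⟨key W hcm hs hnsq hr, ?_⟩
  intro d hd Wd _ _ hWd hrd
  have hd0 : (d : ℚ) ≠ 0 := by
    have hdz : d ≠ 0 := by
      rintro rfl
      rw [Int.gcd_zero_left, Int.natAbs_mul] at hd
      simp at hd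
    exact_mod_cast hdz
  have hiff := Literature.NumberTheory.EllipticCurves.hasCM_iff_j_mem_of_heegnerStarkPrime
    Literature.NumberTheory.QuadraticFields.BinaryQuadraticForm.HeegnerStarkPrimeThreeModEight_holds
  haveI := W.isElliptic_quadraticTwist hd0
  have hjt : (W.quadraticTwist (d : ℚ)).j = W.j := W.j_quadraticTwist hd0
  obtain ⟨C, hC⟩ := hWd
  have hcmd : ¬ Wd.HasCM := by
    subst hC
    intro h
    apply hcm
    rw [hiff] at h ⊢
    rwa [WeierstrassCurve.variableChange_j, hjt] at h
  have hsd : Wd.HasSurjectiveModNGaloisRep (2 : ℤ) := by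
    subst hC
    exact Literature.NumberTheory.EllipticCurves.hasSurjectiveModNGaloisRep_smul _ C 2
      ((Literature.NumberTheory.EllipticCurves.hasSurjectiveModNGaloisRep_two_quadraticTwist_iff W hd0).mpr hs)
  have hnsqd : ¬ IsSquare (-(Wd.Δ)) := by
    subst hC
    exact not_isSquare_neg_delta_smul_quadraticTwist W C hd0 hnsq
  exact key Wd hcmd hsd hnsqd hrd

end Summit.BirchSwinnertonDyer.BirchSwinnertonDyer.Theorems.DefiniteGrossGlue
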